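import Summits.QuantumFields.YangMills.Theorems.SwapVirialDeficitBlowUpGnomonicRingChartTranslated
import Summits.QuantumFields.YangMills.Theorems.SwapVirialDeficitBlowUpGnomonicRingChartReal
import HarnessLib

/-!
# THE TRANSLATED JOINT GNOMONIC RING CHART, BOCHNER FORM (bounded REAL integrands; sector-001 plumbing of LEAD sfw-p2 g98's memo7 plan of record for
# ⟨stmt-QuantumFields-24197⟩ `SwapVirialDeficit.SwapGluedStiffness`, §E(5))

The verbatim twin of ✓`…BlowUpGnomonicRingChartReal` (w2 g57) for the translated chart ✓`trGnomonicPoint u a ε η` (`y`-letter left-translated by a unit `u`,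
`C₂ = Q(u·ŷ)`): ✓`lintegral_ringMeasure_eq_trGnomonic` (`[0,∞]`-valued) turned into the Bochner identity for every bounded measurable seam-invariant real `G`.
* §1 (bounded measurable `G`, `|G| ≤ M`): `measurable_trGnomonic_integrand_real` ∕ `_prod` (joint in `(a, η)`), ★ `integrable_trGnomonic_fibre`,
  `abs_integral_trGnomonic_fibre_le` (`≤ M·∫gnoDensity`), ★ `stronglyMeasurable_trGnomonic_fibre_integral`, ★ `integrable_trGnomonic_fibre_sum`;
* §2 ★★ `integral_ringMeasure_eq_trGnomonic_of_nonneg` (`0 ≤ G ≤ M`), ★★★ `integral_ringMeasure_eq_trGnomonic (hu) (κ) (hχ) (hG) (hbd : ∀ p, |G p| ≤ M) (hinv)` —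
  `∫ G dμ_L = (coneConst³/64 · (2π²)^{-|Fol L|}) · ∫_cone Σ_{ε : GnoSign L} ∫_{η : GnoCoord L} G(fixHistory (ringConfig χ (blowUpPoint 1 (trGnomonicPoint u a ε η))))·gnoDensity η dη da`
  (shift trick `G + M`, minus the constant).
HONEST LABEL: an exact change of variables at fixed `L`; nothing about ⟨24197⟩, ⟨24194⟩ or any rung is proved here; the Yang–Mills mass gap is NOT proved; no summit
is proved by a line.  THEOREMS ONLY (0 `def`, 0 `sorry`), standard axioms.  Seat ym-line-fcl-p3 g47 (cell ym-idea-1, free hands ➎ assembler; item of record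
⟨24085⟩ aside, untouched), `--supports stmt-QuantumFields-24197`.  References: [cite: tHooft1979]; [cite: Luscher1983, §2]; [folklore].
-/

set_option autoImplicit false
set_option synthInstance.maxSize 1024

noncomputable section

open MeasureTheory Quaternion Set
open scoped Quaternion ENNReal BigOperators
open Literature.MathematicalPhysics.QuantumLattice
open Literature.MathematicalPhysics.QuantumFieldTheory hiding SU2
open Summit.QuantumFields.YangMills.Theorems.SwapTwistDeficit.ToronLog

attribute [local instance] Literature.Analysis.FluidPDE.Tao2016.quatMeasurableSpace
  Literature.Analysis.FluidPDE.Tao2016.quatBorelSpace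
  Literature.MathematicalPhysics.QuantumLattice.secondCountableTopology_su2

namespace Summit.QuantumFields.YangMills.Theorems.SwapVirialDeficit.BlowUpRing

open Summit.QuantumFields.YangMills.Theorems.FemtoTransferGap
open Summit.QuantumFields.YangMills.Theorems.FemtoTransferGap.TT
open Summit.QuantumFields.YangMills.Theorems.VirialFluxGap.RingDeficit
open Summit.QuantumFields.YangMills.Theorems.SwapVirialDeficit.SwapRing

variable {L : ℕ} [NeZero L]

/-! ## §1 Measurability and integrability of the translated fibre integrand for a bounded real integrand -/

section Fibre

variable (χ : Site 3 L → SU2) {G : (Fin (2 * L - 1 + 1) → GaugeConfig 3 L SU2) × (Site 3 L → SU2) → ℝ} (u : ℍ)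

/-- The real integrand read in the translated chart is measurable in `η`. [folklore] -/
theorem measurable_trGnomonic_integrand_real (hG : Measurable G) (a : ℍ) (ε : GnoSign L) :
    Measurable fun η : GnoCoord L => G (fixHistory (ringConfig χ (blowUpPoint 1 (trGnomonicPoint u a ε η)))) :=
  hG.comp (measurable_fixHistory.comp ((measurable_ringConfig χ).comp ((measurable_blowUpPoint 1).comp (measurable_trGnomonicPoint u a ε))))

/-- The real integrand read in the translated chart is JOINTLY measurable in `(a, η)`. [folklore] -/
theorem measurable_trGnomonic_integrand_prod (hG : Measurable G) (ε : GnoSign L) :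
    Measurable fun p : ℍ × GnoCoord L => G (fixHistory (ringConfig χ (blowUpPoint 1 (trGnomonicPoint u p.1 ε p.2)))) :=
  hG.comp (measurable_fixHistory.comp ((measurable_ringConfig χ).comp ((measurable_blowUpPoint 1).comp (measurable_trGnomonicPoint_uncurry u ε))))

/-- ★ The translated fibre integrand `η ↦ G(…)·gnoDensity η` of a BOUNDED measurable `G` is integrable (✓`integrable_gnoDensity`). [folklore] -/
theorem integrable_trGnomonic_fibre (hG : Measurable G) {M : ℝ} (hbd : ∀ p, |G p| ≤ M) (a : ℍ) (ε : GnoSign L) :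
    Integrable (fun η : GnoCoord L => G (fixHistory (ringConfig χ (blowUpPoint 1 (trGnomonicPoint u a ε η)))) * gnoDensity η) :=
  (integrable_gnoDensity.const_mul M).mono' ((measurable_trGnomonic_integrand_real χ u hG a ε).mul measurable_gnoDensity).aestronglyMeasurable
    (Filter.Eventually.of_forall fun η => by
      rw [Real.norm_eq_abs, abs_mul, abs_of_nonneg (gnoDensity_pos η).le]
      exact mul_le_mul_of_nonneg_right (hbd _) (gnoDensity_pos η).le)

/-- `|∫ G(…)·gnoDensity| ≤ M · ∫ gnoDensity` in the translated chart. [folklore] -/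
theorem abs_integral_trGnomonic_fibre_le {M : ℝ} (hbd : ∀ p, |G p| ≤ M) (a : ℍ) (ε : GnoSign L) :
    |∫ η : GnoCoord L, G (fixHistory (ringConfig χ (blowUpPoint 1 (trGnomonicPoint u a ε η)))) * gnoDensity η| ≤ M * ∫ η : GnoCoord L, gnoDensity η := by
  rw [← integral_const_mul]
  refine (abs_integral_le_integral_abs).trans (integral_mono_of_nonneg (Filter.Eventually.of_forall fun η => abs_nonneg _)
    (integrable_gnoDensity.const_mul M) (Filter.Eventually.of_forall fun η => ?_))
  show |G (fixHistory (ringConfig χ (blowUpPoint 1 (trGnomonicPoint u a ε η)))) * gnoDensity η| ≤ M * gnoDensity η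
  rw [abs_mul, abs_of_nonneg (gnoDensity_pos η).le]
  exact mul_le_mul_of_nonneg_right (hbd _) (gnoDensity_pos η).le

/-- ★ The translated fibre integral `a ↦ ∫ G(…)·gnoDensity` is strongly measurable in the hub. [folklore] -/
theorem stronglyMeasurable_trGnomonic_fibre_integral (hG : Measurable G) (ε : GnoSign L) :
    StronglyMeasurable fun a : ℍ => ∫ η : GnoCoord L, G (fixHistory (ringConfig χ (blowUpPoint 1 (trGnomonicPoint u a ε η)))) * gnoDensity η := by
  have h : StronglyMeasurable fun p : ℍ × GnoCoord L => G (fixHistory (ringConfig χ (blowUpPoint 1 (trGnomonicPoint u p.1 ε p.2)))) * gnoDensity p.2 :=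
    ((measurable_trGnomonic_integrand_prod χ u hG ε).mul (measurable_gnoDensity.comp measurable_snd)).stronglyMeasurable
  exact h.integral_prod_right'

/-- ★ The summed translated fibre integral `a ↦ Σ_ε ∫ G(…)·gnoDensity` is integrable for the cone law. [folklore] -/
theorem integrable_trGnomonic_fibre_sum (hG : Measurable G) {M : ℝ} (hbd : ∀ p, |G p| ≤ M) :
    Integrable (fun a : ℍ => ∑ ε : GnoSign L, ∫ η : GnoCoord L, G (fixHistory (ringConfig χ (blowUpPoint 1 (trGnomonicPoint u a ε η)))) * gnoDensity η)
      coneMeasure := by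
  haveI := isProbabilityMeasure_coneMeasure
  refine integrable_finsetSum _ fun ε _ => ?_
  exact (integrable_const (M * ∫ η : GnoCoord L, gnoDensity η)).mono' (stronglyMeasurable_trGnomonic_fibre_integral χ u hG ε).aestronglyMeasurable
    (Filter.Eventually.of_forall fun a => by rw [Real.norm_eq_abs]; exact abs_integral_trGnomonic_fibre_le χ u hbd a ε)

end Fibre

/-! ## §2 The Bochner form of the translated joint gnomonic ring chart -/

/-- ★★ **NON-NEGATIVE BOUNDED INTEGRANDS, TRANSLATED CHART**: for central `χ`, a unit `u` and measurable seam-invariant `0 ≤ G ≤ M`,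
`∫ G dμ_L = (coneConst³/64 · (2π²)^{-|Fol L|}) · ∫_cone Σ_ε ∫_η G(fixHistory (ringConfig χ (blowUpPoint 1 (trGnomonicPoint u a ε η))))·gnoDensity η dη da`
(`ENNReal.toReal` of ✓`lintegral_ringMeasure_eq_trGnomonic`). [cite: Luscher1983, §2] -/
theorem integral_ringMeasure_eq_trGnomonic_of_nonneg {u : ℍ} (hu : ‖u‖ = 1) (κ : Site 3 L → Site 3 L) {χ : Site 3 L → SU2}
    (hχ : ∀ (x : Site 3 L) (k : SU2), k * χ x = χ x * k)
    {G : (Fin (2 * L - 1 + 1) → GaugeConfig 3 L SU2) × (Site 3 L → SU2) → ℝ} (hG : Measurable G) (h0 : ∀ p, 0 ≤ G p) {M : ℝ} (hM : ∀ p, G p ≤ M)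
    (hinv : ∀ (h : Site 3 L → SU2) (p : (Fin (2 * L - 1 + 1) → GaugeConfig 3 L SU2) × (Site 3 L → SU2)),
      G ((fun i => gaugeTransform h (p.1 i)), h * p.2 * (h ∘ κ)⁻¹) = G p) :
    ∫ p, G p ∂(ringMeasure L) =
      (coneConst ^ 3 / 64 * (1 / (2 * Real.pi ^ 2)) ^ Fintype.card (Fol L)) *
        ∫ a, (∑ ε : GnoSign L, ∫ η : GnoCoord L, G (fixHistory (ringConfig χ (blowUpPoint 1 (trGnomonicPoint u a ε η)))) * gnoDensity η) ∂coneMeasure := by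
  haveI := isProbabilityMeasure_coneMeasure
  have hbd : ∀ p, |G p| ≤ M := fun p => by rw [abs_of_nonneg (h0 p)]; exact hM p
  have hKr : (0 : ℝ) ≤ coneConst ^ 3 / 64 * (1 / (2 * Real.pi ^ 2)) ^ Fintype.card (Fol L) := by
    have := coneConst_pos; positivity
  have hGE : Measurable fun p => ENNReal.ofReal (G p) := ENNReal.measurable_ofReal.comp hG
  have key := lintegral_ringMeasure_eq_trGnomonic hu κ hχ hGE (fun h p => by simp only [hinv h p])
  have hfib : ∀ (a : ℍ) (ε : GnoSign L),
      ∫⁻ η : GnoCoord L, ENNReal.ofReal (G (fixHistory (ringConfig χ (blowUpPoint 1 (trGnomonicPoint u a ε η))))) * ENNReal.ofReal (gnoDensity η) =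
        ENNReal.ofReal (∫ η : GnoCoord L, G (fixHistory (ringConfig χ (blowUpPoint 1 (trGnomonicPoint u a ε η)))) * gnoDensity η) := fun a ε => by
    rw [ofReal_integral_eq_lintegral_ofReal (integrable_trGnomonic_fibre χ u hG hbd a ε)
      (Filter.Eventually.of_forall fun η => mul_nonneg (h0 _) (gnoDensity_pos η).le)]
    refine lintegral_congr fun η => ?_
    rw [← ENNReal.ofReal_mul (h0 _)]
  have hsum : ∀ a : ℍ, (∑ ε : GnoSign L, ∫⁻ η : GnoCoord L,
      ENNReal.ofReal (G (fixHistory (ringConfig χ (blowUpPoint 1 (trGnomonicPoint u a ε η))))) * ENNReal.ofReal (gnoDensity η)) =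
        ENNReal.ofReal (∑ ε : GnoSign L, ∫ η : GnoCoord L, G (fixHistory (ringConfig χ (blowUpPoint 1 (trGnomonicPoint u a ε η)))) * gnoDensity η) :=
    fun a => by
      rw [ENNReal.ofReal_sum_of_nonneg fun ε _ => integral_nonneg fun η => mul_nonneg (h0 _) (gnoDensity_pos η).le]
      exact Finset.sum_congr rfl fun ε _ => hfib a ε
  have hnn : ∀ a : ℍ, 0 ≤ ∑ ε : GnoSign L, ∫ η : GnoCoord L, G (fixHistory (ringConfig χ (blowUpPoint 1 (trGnomonicPoint u a ε η)))) * gnoDensity η :=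
    fun a => Finset.sum_nonneg fun ε _ => integral_nonneg fun η => mul_nonneg (h0 _) (gnoDensity_pos η).le
  rw [integral_eq_lintegral_of_nonneg_ae (Filter.Eventually.of_forall h0) hG.aestronglyMeasurable, key, lintegral_congr hsum,
    ← ofReal_integral_eq_lintegral_ofReal (integrable_trGnomonic_fibre_sum χ u hG hbd) (Filter.Eventually.of_forall hnn),
    ENNReal.toReal_mul, ENNReal.toReal_ofReal hKr, ENNReal.toReal_ofReal (integral_nonneg hnn)]

set_option maxHeartbeats 400000 in
/-- ★★★ **THE TRANSLATED JOINT GNOMONIC RING CHART, BOCHNER FORM**: for central `χ`, a unit `u` and every BOUNDED measurable seam-invariant real `G` (`|G| ≤ M`),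
`∫ G dμ_L = (coneConst³/64 · (2π²)^{-|Fol L|}) · ∫_cone Σ_{ε : GnoSign L} ∫_{η : GnoCoord L} G(fixHistory (ringConfig χ (blowUpPoint 1 (trGnomonicPoint u a ε η))))·gnoDensity η dη da`
(shift trick: the non-negative form for `G + M` and for the constant `M`, subtracted). [cite: Luscher1983, §2] -/
theorem integral_ringMeasure_eq_trGnomonic {u : ℍ} (hu : ‖u‖ = 1) (κ : Site 3 L → Site 3 L) {χ : Site 3 L → SU2}
    (hχ : ∀ (x : Site 3 L) (k : SU2), k * χ x = χ x * k)
    {G : (Fin (2 * L - 1 + 1) → GaugeConfig 3 L SU2) × (Site 3 L → SU2) → ℝ} (hG : Measurable G) {M : ℝ} (hbd : ∀ p, |G p| ≤ M)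
    (hinv : ∀ (h : Site 3 L → SU2) (p : (Fin (2 * L - 1 + 1) → GaugeConfig 3 L SU2) × (Site 3 L → SU2)),
      G ((fun i => gaugeTransform h (p.1 i)), h * p.2 * (h ∘ κ)⁻¹) = G p) :
    ∫ p, G p ∂(ringMeasure L) =
      (coneConst ^ 3 / 64 * (1 / (2 * Real.pi ^ 2)) ^ Fintype.card (Fol L)) *
        ∫ a, (∑ ε : GnoSign L, ∫ η : GnoCoord L, G (fixHistory (ringConfig χ (blowUpPoint 1 (trGnomonicPoint u a ε η)))) * gnoDensity η) ∂coneMeasure := by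
  haveI : IsProbabilityMeasure (ringMeasure L) := isProbabilityMeasure_ringMeasure (L := L)
  haveI := isProbabilityMeasure_coneMeasure
  have hM : 0 ≤ M := (abs_nonneg _).trans (hbd (Classical.arbitrary _))
  have h1 := integral_ringMeasure_eq_trGnomonic_of_nonneg hu κ hχ (G := fun p => G p + M) (hG.add_const M)
    (fun p => by linarith [neg_le_of_abs_le (hbd p)]) (M := 2 * M) (fun p => by linarith [le_of_abs_le (hbd p)])
    (fun h p => by simp only [hinv h p])
  have h2 := integral_ringMeasure_eq_trGnomonic_of_nonneg hu κ hχ (G := fun _ => M) measurable_const (fun _ => hM) (M := M) (fun _ => le_rfl)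
    (fun _ _ => rfl)
  have hbd1 : ∀ p, |G p + M| ≤ 2 * M := fun p => abs_le.2 ⟨by linarith [neg_le_of_abs_le (hbd p)], by linarith [le_of_abs_le (hbd p)]⟩
  have hbd2 : ∀ _p : (Fin (2 * L - 1 + 1) → GaugeConfig 3 L SU2) × (Site 3 L → SU2), |M| ≤ M := fun _ => (abs_of_nonneg hM).le
  have hGi : Integrable G (ringMeasure L) :=
    (integrable_const M).mono' hG.aestronglyMeasurable (Filter.Eventually.of_forall fun p => by rw [Real.norm_eq_abs]; exact hbd p)
  have eL : ∫ p, G p ∂(ringMeasure L) = (∫ p, (G p + M) ∂(ringMeasure L)) - ∫ _p, M ∂(ringMeasure L) := by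
    rw [integral_add hGi (integrable_const M)]; ring
  have efib : ∀ (a : ℍ) (ε : GnoSign L),
      (∫ η : GnoCoord L, (G (fixHistory (ringConfig χ (blowUpPoint 1 (trGnomonicPoint u a ε η)))) + M) * gnoDensity η) -
          ∫ η : GnoCoord L, M * gnoDensity η =
        ∫ η : GnoCoord L, G (fixHistory (ringConfig χ (blowUpPoint 1 (trGnomonicPoint u a ε η)))) * gnoDensity η := fun a ε => by
    rw [← integral_sub (integrable_trGnomonic_fibre χ u (G := fun p => G p + M) (hG.add_const M) hbd1 a ε) (integrable_gnoDensity.const_mul M)]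
    refine integral_congr_ae (Filter.Eventually.of_forall fun η => ?_)
    show (G (fixHistory (ringConfig χ (blowUpPoint 1 (trGnomonicPoint u a ε η)))) + M) * gnoDensity η - M * gnoDensity η = _
    ring
  rw [eL, h1, h2, ← mul_sub, ← integral_sub (integrable_trGnomonic_fibre_sum χ u (G := fun p => G p + M) (hG.add_const M) hbd1)
    (integrable_trGnomonic_fibre_sum χ u (G := fun _ => M) measurable_const hbd2)]
  congr 1
  refine integral_congr_ae (Filter.Eventually.of_forall fun a => ?_)
  show (∑ ε : GnoSign L, ∫ η : GnoCoord L, (G (fixHistory (ringConfig χ (blowUpPoint 1 (trGnomonicPoint u a ε η)))) + M) * gnoDensity η) -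
      ∑ ε : GnoSign L, ∫ η : GnoCoord L, M * gnoDensity η = _
  rw [← Finset.sum_sub_distrib]
  exact Finset.sum_congr rfl fun ε _ => efib a ε

end Summit.QuantumFields.YangMills.Theorems.SwapVirialDeficit.BlowUpRing

end
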